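import Summits.ValiantsHypothesis.ValiantsHypothesis.Theorems.GrenetZeonDualUnipotentThreeHalvesHeavyTopHalfSpeedSeam

/-!
# `GrenetZeon.DualUnipotentThreeHalves` (stmt-ValiantsHypothesis-24318), LINE β `half_speed`, stub K1 (iii) — the CERTIFY LEAF on an
# arbitrary finite index type: C⁺ (`HalfSpeedIrrLaw`, stated on `Fin d`) transported to an irreducible nilpotent space over `ι`

The chain loop ✓ `exists_halfSpeed_chain` runs over level SUBTYPES `{i // lvl i = t}`; C⁺ = `HalfSpeedIrrLaw` speaks about
`Fin d`.  `exists_certify_leaf_fintype` bridges: for `U ≤ M_ι(ℂ)` nilpotent and IRREDUCIBLE (only `⊥`, `⊤` invariant), C⁺ gives, at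
every height `1 ≤ Θ ≤ card ι`, a `T ≤ U` with `HalfSpeed Θ U T` and `Θ·(finrank U − finrank T) ≤ C·(card ι)²` — by reindexing
along `Fintype.equivFin ι` (nilpotency and irreducibility transported; ✓ `halfSpeed_reindex` back).
Honest framing: plumbing for a stub of LINE β; C⁺ is a HYPOTHESIS here; nothing proves `HalfSpeedLaw`, `HalfSpeedIrrLaw`,
`HeavyTopLaw`, 24318, S3b or 8062; `VP ≠ VNP` is not moved; no summit statement is proved here.  No definitions, no named facts.
[β card K1 (iii); val-port-3 g2]
-/

noncomputable section

-- single-conjunct layout: Sub = Summit, duplicated namespace component intended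
set_option linter.dupNamespace false

namespace Summit.ValiantsHypothesis.ValiantsHypothesis.Theorems.GrenetZeon.HalfSpeed

open Matrix

/-- Reindexing transports the action on vectors: `reindex e e A *ᵥ (x ∘ e.symm) = (A *ᵥ x) ∘ e.symm`. -/
theorem reindex_mulVec_comp {ι κ : Type*} [Fintype ι] [Fintype κ] (e : ι ≃ κ) (A : Matrix ι ι ℂ) (x : ι → ℂ) :
    Matrix.reindex e e A *ᵥ (x ∘ e.symm) = (A *ᵥ x) ∘ e.symm := by
  ext k
  simp only [Matrix.reindex_apply, Matrix.mulVec, dotProduct, Matrix.submatrix_apply, Function.comp_apply]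
  exact Fintype.sum_equiv e.symm _ _ (fun _ => rfl)

/-- **CERTIFY LEAF over any finite index type.**  C⁺ transported from `Fin (card ι)` to `ι`. [β card K1 (iii)] -/
theorem exists_certify_leaf_fintype (hC : HalfSpeedIrrLaw) :
    ∃ C : ℕ, ∀ {ι : Type} [Fintype ι] [DecidableEq ι] (U : Submodule ℂ (Matrix ι ι ℂ)), (∀ A ∈ U, IsNilpotent A) →
      (∀ V : Submodule ℂ (ι → ℂ), (∀ A ∈ U, ∀ x ∈ V, A *ᵥ x ∈ V) → V = ⊥ ∨ V = ⊤) →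
      ∀ Θ : ℕ, 1 ≤ Θ → Θ ≤ Fintype.card ι →
        ∃ T : Submodule ℂ (Matrix ι ι ℂ), T ≤ U ∧
          Θ * (Module.finrank ℂ U - Module.finrank ℂ T) ≤ C * Fintype.card ι ^ 2 ∧
          HalfSpeed Θ (U : Set (Matrix ι ι ℂ)) (T : Set (Matrix ι ι ℂ)) := by
  obtain ⟨C, hC⟩ := hC
  refine ⟨C, ?_⟩
  intro ι _ _ U hnil hirr Θ hΘ1 hΘd
  set d := Fintype.card ι
  let e : ι ≃ Fin d := Fintype.equivFin ι
  -- transport `U` to `Fin d`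
  let R : Matrix ι ι ℂ ≃ₗ[ℂ] Matrix (Fin d) (Fin d) ℂ := Matrix.reindexLinearEquiv ℂ ℂ e e
  have hR : ∀ A, R A = Matrix.reindex e e A := fun _ => rfl
  let U' : Submodule ℂ (Matrix (Fin d) (Fin d) ℂ) := U.map R.toLinearMap
  have hmemU' : ∀ B, B ∈ U' ↔ Matrix.reindex e.symm e.symm B ∈ U := by
    intro B
    constructor
    · intro hB
      obtain ⟨A, hA, rfl⟩ := Submodule.mem_map.1 hB
      change Matrix.reindex e.symm e.symm (Matrix.reindex e e A) ∈ U
      simpa using hA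
    · intro hB
      refine Submodule.mem_map.2 ⟨_, hB, ?_⟩
      change Matrix.reindex e e (Matrix.reindex e.symm e.symm B) = B
      simp
  have hnil' : ∀ B ∈ U', IsNilpotent B := by
    intro B hB
    obtain ⟨A, hA, rfl⟩ := Submodule.mem_map.1 hB
    change IsNilpotent (Matrix.reindexAlgEquiv ℂ ℂ e A)
    exact (hnil A hA).map _
  have hirr' : ∀ V : Submodule ℂ (Fin d → ℂ), (∀ B ∈ U', ∀ x ∈ V, B *ᵥ x ∈ V) → V = ⊥ ∨ V = ⊤ := by
    intro V hV
    -- pull `V` back to `ι → ℂ` along `x ↦ x ∘ e`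
    let Φ : (ι → ℂ) ≃ₗ[ℂ] (Fin d → ℂ) := LinearEquiv.funCongrLeft ℂ ℂ e.symm
    have hΦ : ∀ x : ι → ℂ, Φ x = x ∘ e.symm := fun x => rfl
    let W : Submodule ℂ (ι → ℂ) := V.comap Φ.toLinearMap
    have hW : ∀ A ∈ U, ∀ x ∈ W, A *ᵥ x ∈ W := by
      intro A hA x hx
      change Φ (A *ᵥ x) ∈ V
      rw [hΦ, ← reindex_mulVec_comp]
      exact hV _ (Submodule.mem_map.2 ⟨A, hA, rfl⟩) _ hx
    rcases hirr W hW with h | h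
    · left
      rw [eq_bot_iff]
      intro y hy
      have : Φ.symm y ∈ W := by
        change Φ (Φ.symm y) ∈ V; simpa using hy
      rw [h, Submodule.mem_bot] at this
      simpa using congrArg Φ this
    · right
      rw [eq_top_iff]
      intro y _
      have : Φ.symm y ∈ W := by rw [h]; exact Submodule.mem_top
      change Φ (Φ.symm y) ∈ V at this
      simpa using this
  obtain ⟨T', hT'U', hcod, hprof⟩ := hC d U' hnil' hirr' Θ hΘ1 hΘd
  -- pull back
  let T : Submodule ℂ (Matrix ι ι ℂ) := T'.comap R.toLinearMap
  have hTU : T ≤ U := by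
    intro A hA
    have : R A ∈ U' := hT'U' hA
    rw [hmemU'] at this
    change Matrix.reindex e.symm e.symm (Matrix.reindex e e A) ∈ U at this
    simpa using this
  have hfinU : Module.finrank ℂ U' = Module.finrank ℂ U :=
    (LinearEquiv.finrank_eq (Submodule.equivMapOfInjective _ R.injective _)).symm
  have hTmap : T' = T.map R.toLinearMap := by
    ext B
    constructor
    · intro hB
      refine Submodule.mem_map.2 ⟨R.symm B, ?_, by simp⟩
      change R (R.symm B) ∈ T'; simpa using hB
    · intro hB
      obtain ⟨A, hA, rfl⟩ := Submodule.mem_map.1 hB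
      exact hA
  have hfinT : Module.finrank ℂ T' = Module.finrank ℂ T := by
    rw [hTmap]; exact (LinearEquiv.finrank_eq (Submodule.equivMapOfInjective _ R.injective _)).symm
  refine ⟨T, hTU, ?_, ?_⟩
  · rw [← hfinU, ← hfinT]; exact hcod
  · have hback := halfSpeed_reindex e.symm Θ _ _ hprof
    refine halfSpeed_anti ?_ ?_ hback
    · intro A hA
      exact ⟨Matrix.reindex e e A, Submodule.mem_map.2 ⟨A, hA, rfl⟩, by simp⟩
    · intro A hA
      exact ⟨Matrix.reindex e e A, hA, by simp⟩

end Summit.ValiantsHypothesis.ValiantsHypothesis.Theorems.GrenetZeon.HalfSpeed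

end
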